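import Literature.Barriers.CriticalPhenomena.LaceExpansionIsingGreenComparisonSymbols
import HarnessLib

/-!
# Liu–Slade 2026, Lemma 3.4 (= Liu–Slade 2024, Lemma 2.2) for the pure derivatives:
# `|∂_l^m Ê(k)| ≤ cK|k|^{2+σ-m}` from vanishing zeroth and second moments

Barrier catalogue `Literature/Barriers/CriticalPhenomena/` (D-0021), infrastructure for the proof
of the named fact `SpreadOutIsing.LiuSlade2026_thm22` (Liu–Slade 2026, Theorem 2.2), whose
Lemma 3.3 rests on Lemma 3.4: "Suppose `E : ℤ^d → ℝ` is `ℤ^d`-symmetric, has vanishing zeroth and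
second moments as in (3.4) [`Σ_x E(x) = Σ_x |x|²E(x) = 0`], and satisfies `|E(x)| ≤ K|x|^{-(d+2+ρ)}`
for some `K, ρ > 0`. Choose `σ ∈ (0,ρ)` such that `σ ≤ 2` and let `α` be a multi-index with
`|α| < 2 + σ`. Then there is a constant `c = c(σ,ρ,d)` such that `|Ê_α(k)| ≤ cK|k|^{2+σ-|α|}`."
This file PROVES it for the pure multi-indices `α = m e_l` (the ones the one-axis form of
Lemma 3.1 consumes), with the transform `Ê(k) = Σ_x E(x)cos(k·x)` of a symmetric function and its
slice derivatives written as the series `Σ_x E(x) x_l^m cos(k·x + mπ/2)` (the form produced by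
`(d/dt)^m cos(at + b) = a^m cos(at + b + mπ/2)`, cf. the tree's `soSymbolD`), and the explicit
constant `c = 3 Σ_x ⟦x⟧^{-(d+ρ-σ)}` (`|k| = knorm k`, Euclidean):

* `abs_tsum_moment_cos_le` — **the lemma**: for `0 ≤ σ < ρ`, `σ ≤ 2`, `m < 2 + σ`,
  `|Σ_x E(x) x_l^m cos(k·x + mπ/2)| ≤ 3K (Σ_x ⟦x⟧^{-(d+ρ-σ)}) |k|^{2+σ-m}`;
* the four cases behind it (the printed proof, [LS24a] Lemma 2.2: subtract the vanishing Taylor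
  terms allowed by the moment conditions and `ℤ^d`-symmetry, then bound termwise):
  `m = 0`: `Σ E cos(k·x) = Σ E (cos(k·x) - 1 + (k·x)²/2)` (`Σ E = 0`, `Σ E (k·x)² = |k|²d⁻¹Σ|x|²E = 0`)
  and `|cos u - 1 + u²/2| ≤ (5/2)|u|^{2+σ}`; `m = 1`: `Σ E x_l sin(k·x) = Σ E x_l (sin(k·x) - k·x)`
  (`Σ E x_l x_i = 0`) and `|sin u - u| ≤ 2|u|^{1+σ}`; `m = 2`: `Σ E x_l² cos(k·x) = Σ E x_l²(cos(k·x) - 1)`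
  (`Σ E x_l² = 0`) and `|cos u - 1| ≤ 2|u|^σ`; `m = 3` (`σ > 1`): `|sin u| ≤ |u|^{σ-1}`.

## References

* Y. Liu, G. Slade, *Gaussian deconvolution and the lace expansion for spread-out models*,
  Ann. Inst. H. Poincaré Probab. Statist. 62 (2026), arXiv:2310.07640: Lemma 3.4 [LiuSlade2026].
* Y. Liu, G. Slade, *Gaussian deconvolution and the lace expansion*, Probab. Theory Related
  Fields 195 (2024), arXiv:2310.07635: Lemma 2.2 and its proof (§2.2) [LiuSlade2024].
-/

noncomputable section

namespace Literature.Barriers.CriticalPhenomena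

open Finset Filter Literature.Probability.LatticeModels
open scoped BigOperators Real

variable {d : ℕ}

/-! ## Scalar Taylor bounds in Hölder form -/

/-- `|sin u - u| ≤ 2|u|^{1+σ}` for `0 ≤ σ ≤ 2`. [cite: LiuSlade2024, proof of Lemma 2.2 (Taylor bounds)] -/
theorem abs_sin_sub_self_le_rpow (u : ℝ) {σ : ℝ} (hσ0 : 0 ≤ σ) (hσ2 : σ ≤ 2) :
    |Real.sin u - u| ≤ 2 * |u| ^ (1 + σ) := by
  rcases (abs_nonneg u).eq_or_lt with h0 | h0
  · have hu : u = 0 := abs_eq_zero.1 h0.symm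
    subst hu
    simp [Real.zero_rpow (by linarith : (1 : ℝ) + σ ≠ 0)]
  rcases le_or_gt |u| 1 with h | h
  · have h3 : |u| ^ ((3 : ℕ) : ℝ) ≤ |u| ^ (1 + σ) :=
      Real.rpow_le_rpow_of_exponent_ge h0 h (by push_cast; linarith)
    rw [Real.rpow_natCast] at h3
    calc |Real.sin u - u| ≤ |u| ^ 3 / 6 := SpreadOutIsing.abs_sin_sub_le u
      _ ≤ 2 * |u| ^ 3 := by nlinarith [pow_nonneg (abs_nonneg u) 3]
      _ ≤ 2 * |u| ^ (1 + σ) := by linarith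
  · have h1 : |u| ^ (1 : ℝ) ≤ |u| ^ (1 + σ) := Real.rpow_le_rpow_of_exponent_le h.le (by linarith)
    rw [Real.rpow_one] at h1
    calc |Real.sin u - u| ≤ |Real.sin u| + |u| := abs_sub _ _
      _ ≤ 1 + |u| := by linarith [Real.abs_sin_le_one u]
      _ ≤ 2 * |u| := by linarith
      _ ≤ 2 * |u| ^ (1 + σ) := by linarith

/-- `|cos u - 1| ≤ 2|u|^σ` for `0 ≤ σ ≤ 2`. [cite: LiuSlade2024, proof of Lemma 2.2 (Taylor bounds)] -/
theorem abs_cos_sub_one_le_rpow (u : ℝ) {σ : ℝ} (hσ0 : 0 ≤ σ) (hσ2 : σ ≤ 2) :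
    |Real.cos u - 1| ≤ 2 * |u| ^ σ := by
  rcases (abs_nonneg u).eq_or_lt with h0 | h0
  · have hu : u = 0 := abs_eq_zero.1 h0.symm
    subst hu
    simp only [Real.cos_zero, sub_self, abs_zero]
    positivity
  rcases le_or_gt |u| 1 with h | h
  · have h2 : |u| ^ ((2 : ℕ) : ℝ) ≤ |u| ^ σ :=
      Real.rpow_le_rpow_of_exponent_ge h0 h (by push_cast; linarith)
    rw [Real.rpow_natCast, sq_abs] at h2
    calc |Real.cos u - 1| = |1 - Real.cos u| := abs_sub_comm _ _
      _ ≤ u ^ 2 / 2 := SpreadOutIsing.abs_one_sub_cos_le u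
      _ ≤ 2 * |u| ^ σ := by nlinarith [sq_nonneg u]
  · have h1 : (1 : ℝ) ≤ |u| ^ σ := Real.one_le_rpow h.le hσ0
    calc |Real.cos u - 1| ≤ |Real.cos u| + |(1 : ℝ)| := abs_sub _ _
      _ ≤ 1 + 1 := by rw [abs_one]; linarith [Real.abs_cos_le_one u]
      _ ≤ 2 * |u| ^ σ := by linarith

/-- `|sin u| ≤ |u|^τ` for `0 < τ ≤ 1`. [cite: LiuSlade2024, proof of Lemma 2.2 (Taylor bounds)] -/
theorem abs_sin_le_rpow (u : ℝ) {τ : ℝ} (hτ0 : 0 < τ) (hτ1 : τ ≤ 1) : |Real.sin u| ≤ |u| ^ τ := by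
  rcases (abs_nonneg u).eq_or_lt with h0 | h0
  · have hu : u = 0 := abs_eq_zero.1 h0.symm
    subst hu
    simp [Real.zero_rpow hτ0.ne']
  rcases le_or_gt |u| 1 with h | h
  · have h1 : |u| ^ (1 : ℝ) ≤ |u| ^ τ := Real.rpow_le_rpow_of_exponent_ge h0 h hτ1
    rw [Real.rpow_one] at h1
    exact (Real.abs_sin_le_abs (x := u)).trans h1
  · exact (Real.abs_sin_le_one u).trans (Real.one_le_rpow h.le hτ0.le)

/-! ## The setting: decay, symmetry, vanishing moments -/

section Moments

variable {E : Site d → ℝ} {K ρ σ : ℝ}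

/-- Under `|E(x)| ≤ K/⟦x⟧^{d+2+ρ}`: `|E(x)| ⟦x⟧^t ≤ K ⟦x⟧^{t-(d+2+ρ)}`. [folklore] -/
theorem abs_mul_jnorm_rpow_le_of_decay (hdec : ∀ x, |E x| ≤ K / jnorm x ^ ((d : ℝ) + 2 + ρ))
    (x : Site d) (t : ℝ) : |E x| * jnorm x ^ t ≤ K * jnorm x ^ (t - ((d : ℝ) + 2 + ρ)) := by
  have hj := jnorm_pos x
  calc |E x| * jnorm x ^ t ≤ K / jnorm x ^ ((d : ℝ) + 2 + ρ) * jnorm x ^ t :=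
        mul_le_mul_of_nonneg_right (hdec x) (Real.rpow_nonneg hj.le t)
    _ = K * jnorm x ^ (t - ((d : ℝ) + 2 + ρ)) := by
        rw [Real.rpow_sub hj, div_mul_eq_mul_div, mul_div_assoc]

/-- The termwise majorant: for exponents `p, q` with `p + q = 2 + σ`,
`|E(x)| ⟦x⟧^p (|k|⟦x⟧)^q ≤ K |k|^q ⟦x⟧^{-(d+ρ-σ)}`. [folklore] -/
theorem term_majorant (hdec : ∀ x, |E x| ≤ K / jnorm x ^ ((d : ℝ) + 2 + ρ)) {p q : ℝ}
    (hpq : p + q = 2 + σ) (x : Site d) (k : Fin d → ℝ) :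
    |E x| * jnorm x ^ p * (knorm k * jnorm x) ^ q ≤ K * knorm k ^ q * jnorm x ^ (-((d : ℝ) + ρ - σ)) := by
  have hj := jnorm_pos x
  rw [Real.mul_rpow (knorm_nonneg k) hj.le]
  have h := abs_mul_jnorm_rpow_le_of_decay hdec x (p + q)
  rw [Real.rpow_add hj] at h
  have hexp : p + q - ((d : ℝ) + 2 + ρ) = -((d : ℝ) + ρ - σ) := by rw [hpq]; ring
  rw [hexp] at h
  calc |E x| * jnorm x ^ p * (knorm k ^ q * jnorm x ^ q)
      = knorm k ^ q * (|E x| * (jnorm x ^ p * jnorm x ^ q)) := by ring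
    _ ≤ knorm k ^ q * (K * jnorm x ^ (-((d : ℝ) + ρ - σ))) :=
        mul_le_mul_of_nonneg_left h (Real.rpow_nonneg (knorm_nonneg k) q)
    _ = K * knorm k ^ q * jnorm x ^ (-((d : ℝ) + ρ - σ)) := by ring

/-- The lattice constant `Σ_x ⟦x⟧^{-(d+ρ-σ)}` is finite for `σ < ρ`. [folklore] -/
theorem summable_jnorm_rpow_neg_of_lt (hσρ : σ < ρ) :
    Summable fun x : Site d => jnorm x ^ (-((d : ℝ) + ρ - σ)) :=
  summable_jnorm_rpow_neg (by linarith)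

/-- Summability of `⟦x⟧^t |E(x)|` for `t < 2 + ρ`. [folklore] -/
theorem summable_jnorm_rpow_mul_abs (hdec : ∀ x, |E x| ≤ K / jnorm x ^ ((d : ℝ) + 2 + ρ))
    {t : ℝ} (ht : t < 2 + ρ) : Summable fun x => jnorm x ^ t * |E x| := by
  have hs : Summable fun x : Site d => K * jnorm x ^ (t - ((d : ℝ) + 2 + ρ)) := by
    have h := (summable_jnorm_rpow_neg (d := d) (s := (d : ℝ) + 2 + ρ - t) (by linarith)).mul_left K
    refine h.congr fun x => ?_
    congr 1; congr 1; ring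
  refine Summable.of_nonneg_of_le (fun x => mul_nonneg (Real.rpow_nonneg (jnorm_pos x).le t) (abs_nonneg _))
    (fun x => ?_) hs
  rw [mul_comm]
  exact abs_mul_jnorm_rpow_le_of_decay hdec x t

/-- Summability of `E`. [folklore] -/
theorem summable_of_decay (hρ : 0 < ρ)
    (hdec : ∀ x, |E x| ≤ K / jnorm x ^ ((d : ℝ) + 2 + ρ)) : Summable E := by
  have h := summable_jnorm_rpow_mul_abs hdec (t := 0) (by linarith)
  simp only [Real.rpow_zero, one_mul] at h
  exact h.of_abs

/-- Summability of `|x|²|E(x)|`. [folklore] -/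
theorem summable_sq_mul_abs_of_decay (hρ : 0 < ρ)
    (hdec : ∀ x, |E x| ≤ K / jnorm x ^ ((d : ℝ) + 2 + ρ)) :
    Summable fun x => euclidNorm x ^ 2 * |E x| := by
  have h := summable_jnorm_rpow_mul_abs hdec (t := 2) (by linarith)
  refine Summable.of_nonneg_of_le (fun x => mul_nonneg (sq_nonneg _) (abs_nonneg _)) (fun x => ?_) h
  refine mul_le_mul_of_nonneg_right ?_ (abs_nonneg _)
  rw [show ((2 : ℝ)) = ((2 : ℕ) : ℝ) by norm_num, Real.rpow_natCast]
  exact pow_le_pow_left₀ (euclidNorm_nonneg x) (euclidNorm_le_jnorm x) 2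

/-- A generic termwise-bounded series estimate: if `|f(x)| ≤ K|k|^q⟦x⟧^{-(d+ρ-σ)}` then
`|Σ f| ≤ K (Σ⟦x⟧^{-(d+ρ-σ)}) |k|^q`. [folklore] -/
theorem abs_tsum_le_of_term_le (hσρ : σ < ρ) {f : Site d → ℝ} {q : ℝ} (k : Fin d → ℝ)
    (h : ∀ x, |f x| ≤ K * knorm k ^ q * jnorm x ^ (-((d : ℝ) + ρ - σ))) :
    |∑' x, f x| ≤ K * (∑' x : Site d, jnorm x ^ (-((d : ℝ) + ρ - σ))) * knorm k ^ q := by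
  have hs := ((summable_jnorm_rpow_neg_of_lt (d := d) hσρ).mul_left (K * knorm k ^ q)).hasSum
  have := tsum_of_norm_bounded hs fun x => by rw [Real.norm_eq_abs]; exact h x
  rw [Real.norm_eq_abs] at this
  refine this.trans (le_of_eq ?_)
  rw [tsum_mul_left]; ring

/-! ## The four cases -/

/-- **`m = 0`**: `|Σ_x E(x)cos(k·x)| ≤ (5/2)K(Σ⟦x⟧^{-(d+ρ-σ)})|k|^{2+σ}` (`Σ E = 0`,
`Σ (k·x)²E = 0` by symmetry and `Σ|x|²E = 0`, and `|cos u - 1 + u²/2| ≤ (5/2)|u|^{2+σ}`).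
[cite: LiuSlade2026, Lemma 3.4] [cite: LiuSlade2024, Lemma 2.2 and its proof] -/
theorem abs_tsum_mul_cos_le_of_moments (hE : IsZdSymmetric E) (hρ : 0 < ρ)
    (hdec : ∀ x, |E x| ≤ K / jnorm x ^ ((d : ℝ) + 2 + ρ)) (hσ0 : 0 ≤ σ) (hσρ : σ < ρ) (hσ2 : σ ≤ 2)
    (h0 : ∑' x, E x = 0) (h2 : ∑' x, euclidNorm x ^ 2 * E x = 0) (k : Fin d → ℝ) :
    |∑' x, E x * Real.cos (kdot k x)| ≤
      5 / 2 * K * (∑' x : Site d, jnorm x ^ (-((d : ℝ) + ρ - σ))) * knorm k ^ (2 + σ) := by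
  have hEs : Summable E := summable_of_decay hρ hdec
  have hE2 : Summable fun x => euclidNorm x ^ 2 * |E x| := summable_sq_mul_abs_of_decay hρ hdec
  -- summable pieces
  have hcos : Summable fun x => E x * Real.cos (kdot k x) := by
    refine Summable.of_norm_bounded hEs.abs fun x => ?_
    rw [Real.norm_eq_abs, abs_mul]
    exact mul_le_of_le_one_right (abs_nonneg _) (Real.abs_cos_le_one _)
  have hsq : Summable fun x => kdot k x ^ 2 * E x := by
    refine Summable.of_norm_bounded (hE2.mul_left (knorm k ^ 2)) fun x => ?_
    rw [Real.norm_eq_abs, abs_mul, abs_pow]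
    calc |kdot k x| ^ 2 * |E x| ≤ (knorm k * euclidNorm x) ^ 2 * |E x| := by
          gcongr; exact abs_kdot_le k x
      _ = knorm k ^ 2 * (euclidNorm x ^ 2 * |E x|) := by ring
  -- the vanishing moments
  have hsq0 : ∑' x, kdot k x ^ 2 * E x = 0 := by
    rw [tsum_kdot_sq_mul hE hE2 k, h2, mul_zero]
  -- rewrite as one series
  have hid : ∑' x, E x * Real.cos (kdot k x) =
      ∑' x, E x * (Real.cos (kdot k x) - 1 + kdot k x ^ 2 / 2) := by
    have h1 : ∑' x, (E x * Real.cos (kdot k x) - E x) = ∑' x, E x * Real.cos (kdot k x) - ∑' x, E x :=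
      Summable.tsum_sub hcos hEs
    have h3 : ∑' x, ((E x * Real.cos (kdot k x) - E x) + kdot k x ^ 2 * E x / 2) =
        ∑' x, (E x * Real.cos (kdot k x) - E x) + ∑' x, kdot k x ^ 2 * E x / 2 :=
      Summable.tsum_add (hcos.sub hEs) (hsq.div_const 2)
    rw [h1, tsum_div_const, h0, hsq0, sub_zero, zero_div, add_zero] at h3
    rw [← h3]
    exact tsum_congr fun x => by ring
  rw [hid]
  have hmaj : ∀ x, |E x * (Real.cos (kdot k x) - 1 + kdot k x ^ 2 / 2)| ≤
      5 / 2 * K * knorm k ^ (2 + σ) * jnorm x ^ (-((d : ℝ) + ρ - σ)) := by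
    intro x
    rw [abs_mul]
    have hT : |Real.cos (kdot k x) - 1 + kdot k x ^ 2 / 2| ≤ 5 / 2 * |kdot k x| ^ (2 + σ) := by
      have := abs_one_sub_cos_sub_sq_le (kdot k x) hσ0 hσ2
      rwa [show 1 - Real.cos (kdot k x) - kdot k x ^ 2 / 2 = -(Real.cos (kdot k x) - 1 + kdot k x ^ 2 / 2) by ring,
        abs_neg] at this
    have hu : |kdot k x| ^ (2 + σ) ≤ (knorm k * jnorm x) ^ (2 + σ) :=
      Real.rpow_le_rpow (abs_nonneg _) ((abs_kdot_le k x).trans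
        (mul_le_mul_of_nonneg_left (euclidNorm_le_jnorm x) (knorm_nonneg k))) (by linarith)
    have ht := term_majorant hdec (p := 0) (q := 2 + σ) (by ring) x k
    rw [Real.rpow_zero, mul_one] at ht
    calc |E x| * |Real.cos (kdot k x) - 1 + kdot k x ^ 2 / 2| ≤ |E x| * (5 / 2 * (knorm k * jnorm x) ^ (2 + σ)) :=
          mul_le_mul_of_nonneg_left (hT.trans (by linarith)) (abs_nonneg _)
      _ = 5 / 2 * (|E x| * (knorm k * jnorm x) ^ (2 + σ)) := by ring
      _ ≤ 5 / 2 * (K * knorm k ^ (2 + σ) * jnorm x ^ (-((d : ℝ) + ρ - σ))) :=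
          mul_le_mul_of_nonneg_left ht (by norm_num)
      _ = _ := by ring
  have := abs_tsum_le_of_term_le (K := 5 / 2 * K) hσρ k hmaj
  linarith [this]

/-- Summability of `x_l x_i E(x)`-type second-moment families. [folklore] -/
theorem summable_moment_two (hρ : 0 < ρ) (hdec : ∀ x, |E x| ≤ K / jnorm x ^ ((d : ℝ) + 2 + ρ))
    (l i : Fin d) : Summable fun x => ((x l : ℤ) : ℝ) * ((x i : ℤ) : ℝ) * E x :=
  summable_apply_mul_apply_mul (summable_sq_mul_abs_of_decay hρ hdec) l i

/-- **`Σ_x E(x) x_l (k·x) = 0`** for a `ℤ^d`-symmetric `E` with `Σ_x |x|²E(x) = 0` (off-diagonal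
second moments vanish by symmetry, the diagonal one is `d⁻¹Σ|x|²E = 0`).
[cite: LiuSlade2024, proof of Lemma 2.2 ("the first moments of E(x) also vanish, by symmetry")] -/
theorem tsum_mul_apply_mul_kdot_eq_zero (hE : IsZdSymmetric E) (hρ : 0 < ρ)
    (hdec : ∀ x, |E x| ≤ K / jnorm x ^ ((d : ℝ) + 2 + ρ)) (h2 : ∑' x, euclidNorm x ^ 2 * E x = 0)
    (l : Fin d) (k : Fin d → ℝ) :
    ∑' x, E x * (((x l : ℤ) : ℝ) * kdot k x) = 0 := by
  classical
  have hE2 := summable_sq_mul_abs_of_decay hρ hdec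
  have hs : ∀ i, Summable fun x => k i * (((x l : ℤ) : ℝ) * ((x i : ℤ) : ℝ) * E x) := fun i =>
    (summable_moment_two hρ hdec l i).mul_left _
  have hexp : ∀ x, E x * (((x l : ℤ) : ℝ) * kdot k x) = ∑ i, k i * (((x l : ℤ) : ℝ) * ((x i : ℤ) : ℝ) * E x) := by
    intro x
    rw [kdot, Finset.mul_sum, Finset.mul_sum]
    exact Finset.sum_congr rfl fun i _ => by ring
  rw [tsum_congr hexp, Summable.tsum_finsetSum (fun i _ => hs i)]
  refine Finset.sum_eq_zero fun i _ => ?_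
  rw [tsum_mul_left]
  by_cases hil : l = i
  · subst hil
    have h := tsum_sq_apply_mul_eq hE hE2 l
    rw [h2, zero_div] at h
    rw [show (fun x : Site d => ((x l : ℤ) : ℝ) * ((x l : ℤ) : ℝ) * E x) = fun x => ((x l : ℤ) : ℝ) ^ 2 * E x
      from funext fun x => by ring, h, mul_zero]
  · rw [tsum_apply_mul_apply_mul_eq_zero hE hil, mul_zero]

/-- **`m = 1`**: `|Σ_x E(x) x_l sin(k·x)| ≤ 2K(Σ⟦x⟧^{-(d+ρ-σ)})|k|^{1+σ}` (`Σ E x_l (k·x) = 0` and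
`|sin u - u| ≤ 2|u|^{1+σ}`). [cite: LiuSlade2026, Lemma 3.4] [cite: LiuSlade2024, Lemma 2.2 and its proof] -/
theorem abs_tsum_mul_apply_mul_sin_le_of_moments (hE : IsZdSymmetric E) (hρ : 0 < ρ)
    (hdec : ∀ x, |E x| ≤ K / jnorm x ^ ((d : ℝ) + 2 + ρ)) (hσ0 : 0 ≤ σ) (hσρ : σ < ρ) (hσ2 : σ ≤ 2)
    (h2 : ∑' x, euclidNorm x ^ 2 * E x = 0) (l : Fin d) (k : Fin d → ℝ) :
    |∑' x, E x * (((x l : ℤ) : ℝ) * Real.sin (kdot k x))| ≤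
      2 * K * (∑' x : Site d, jnorm x ^ (-((d : ℝ) + ρ - σ))) * knorm k ^ (1 + σ) := by
  have hE2 := summable_sq_mul_abs_of_decay hρ hdec
  have hE1 : Summable fun x => jnorm x ^ (1 : ℝ) * |E x| := summable_jnorm_rpow_mul_abs hdec (by linarith)
  have hxl : ∀ x : Site d, |((x l : ℤ) : ℝ)| ≤ jnorm x := fun x =>
    (abs_apply_le_euclidNorm x l).trans (euclidNorm_le_jnorm x)
  have hsin : Summable fun x => E x * (((x l : ℤ) : ℝ) * Real.sin (kdot k x)) := by
    refine Summable.of_norm_bounded hE1 fun x => ?_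
    rw [Real.norm_eq_abs, abs_mul, abs_mul, Real.rpow_one, mul_comm]
    refine mul_le_mul_of_nonneg_right ?_ (abs_nonneg _)
    calc |((x l : ℤ) : ℝ)| * |Real.sin (kdot k x)| ≤ jnorm x * 1 :=
          mul_le_mul (hxl x) (Real.abs_sin_le_one _) (abs_nonneg _) (jnorm_pos x).le
      _ = jnorm x := mul_one _
  have hlin : Summable fun x => E x * (((x l : ℤ) : ℝ) * kdot k x) := by
    refine Summable.of_norm_bounded (hE2.mul_left (knorm k)) fun x => ?_
    rw [Real.norm_eq_abs, abs_mul, abs_mul]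
    calc |E x| * (|((x l : ℤ) : ℝ)| * |kdot k x|) ≤ |E x| * (euclidNorm x * (knorm k * euclidNorm x)) :=
          mul_le_mul_of_nonneg_left (mul_le_mul (abs_apply_le_euclidNorm x l) (abs_kdot_le k x)
            (abs_nonneg _) (euclidNorm_nonneg x)) (abs_nonneg _)
      _ = knorm k * (euclidNorm x ^ 2 * |E x|) := by ring
  have hid : ∑' x, E x * (((x l : ℤ) : ℝ) * Real.sin (kdot k x)) =
      ∑' x, E x * (((x l : ℤ) : ℝ) * (Real.sin (kdot k x) - kdot k x)) := by
    have h1 := Summable.tsum_sub hsin hlin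
    rw [tsum_mul_apply_mul_kdot_eq_zero hE hρ hdec h2 l k, sub_zero] at h1
    rw [← h1]
    exact tsum_congr fun x => by ring
  rw [hid]
  refine abs_tsum_le_of_term_le (K := 2 * K) hσρ k fun x => ?_
  rw [abs_mul, abs_mul]
  have hT := abs_sin_sub_self_le_rpow (kdot k x) hσ0 hσ2
  have hu : |kdot k x| ^ (1 + σ) ≤ (knorm k * jnorm x) ^ (1 + σ) :=
    Real.rpow_le_rpow (abs_nonneg _) ((abs_kdot_le k x).trans
      (mul_le_mul_of_nonneg_left (euclidNorm_le_jnorm x) (knorm_nonneg k))) (by linarith)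
  have ht := term_majorant hdec (p := 1) (q := 1 + σ) (by ring) x k
  rw [Real.rpow_one] at ht
  calc |E x| * (|((x l : ℤ) : ℝ)| * |Real.sin (kdot k x) - kdot k x|)
      ≤ |E x| * (jnorm x * (2 * (knorm k * jnorm x) ^ (1 + σ))) := by
        refine mul_le_mul_of_nonneg_left (mul_le_mul (hxl x) (hT.trans (by linarith)) (abs_nonneg _)
          (jnorm_pos x).le) (abs_nonneg _)
    _ = 2 * (|E x| * jnorm x * (knorm k * jnorm x) ^ (1 + σ)) := by ring
    _ ≤ 2 * (K * knorm k ^ (1 + σ) * jnorm x ^ (-((d : ℝ) + ρ - σ))) := mul_le_mul_of_nonneg_left ht (by norm_num)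
    _ = _ := by ring

/-- **`m = 2`**: `|Σ_x E(x) x_l² cos(k·x)| ≤ 2K(Σ⟦x⟧^{-(d+ρ-σ)})|k|^σ` (`Σ E x_l² = d⁻¹Σ|x|²E = 0` and
`|cos u - 1| ≤ 2|u|^σ`). [cite: LiuSlade2026, Lemma 3.4] [cite: LiuSlade2024, Lemma 2.2 and its proof] -/
theorem abs_tsum_mul_sq_mul_cos_le_of_moments (hE : IsZdSymmetric E) (hρ : 0 < ρ)
    (hdec : ∀ x, |E x| ≤ K / jnorm x ^ ((d : ℝ) + 2 + ρ)) (hσ0 : 0 ≤ σ) (hσρ : σ < ρ) (hσ2 : σ ≤ 2)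
    (h2 : ∑' x, euclidNorm x ^ 2 * E x = 0) (l : Fin d) (k : Fin d → ℝ) :
    |∑' x, E x * (((x l : ℤ) : ℝ) ^ 2 * Real.cos (kdot k x))| ≤
      2 * K * (∑' x : Site d, jnorm x ^ (-((d : ℝ) + ρ - σ))) * knorm k ^ σ := by
  have hE2 := summable_sq_mul_abs_of_decay hρ hdec
  have hxl2 : ∀ x : Site d, ((x l : ℤ) : ℝ) ^ 2 ≤ euclidNorm x ^ 2 := fun x => by
    rw [← sq_abs]; exact pow_le_pow_left₀ (abs_nonneg _) (abs_apply_le_euclidNorm x l) 2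
  have hsq : Summable fun x => E x * ((x l : ℤ) : ℝ) ^ 2 := by
    refine Summable.of_norm_bounded hE2 fun x => ?_
    rw [Real.norm_eq_abs, abs_mul, abs_of_nonneg (sq_nonneg ((x l : ℤ) : ℝ)), mul_comm]
    exact mul_le_mul_of_nonneg_right (hxl2 x) (abs_nonneg _)
  have hcos : Summable fun x => E x * (((x l : ℤ) : ℝ) ^ 2 * Real.cos (kdot k x)) := by
    refine Summable.of_norm_bounded hE2 fun x => ?_
    rw [Real.norm_eq_abs, abs_mul, abs_mul, abs_of_nonneg (sq_nonneg ((x l : ℤ) : ℝ)), mul_comm]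
    calc ((x l : ℤ) : ℝ) ^ 2 * |Real.cos (kdot k x)| * |E x| ≤ euclidNorm x ^ 2 * 1 * |E x| :=
          mul_le_mul_of_nonneg_right (mul_le_mul (hxl2 x) (Real.abs_cos_le_one _) (abs_nonneg _)
            (sq_nonneg _)) (abs_nonneg _)
      _ = euclidNorm x ^ 2 * |E x| := by ring
  have hsq0 : ∑' x, E x * ((x l : ℤ) : ℝ) ^ 2 = 0 := by
    have h := tsum_sq_apply_mul_eq hE hE2 l
    rw [h2, zero_div] at h
    rw [← h]
    exact tsum_congr fun x => by ring
  have hid : ∑' x, E x * (((x l : ℤ) : ℝ) ^ 2 * Real.cos (kdot k x)) =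
      ∑' x, E x * (((x l : ℤ) : ℝ) ^ 2 * (Real.cos (kdot k x) - 1)) := by
    have h1 := Summable.tsum_sub hcos hsq
    rw [hsq0, sub_zero] at h1
    rw [← h1]
    exact tsum_congr fun x => by ring
  rw [hid]
  refine abs_tsum_le_of_term_le (K := 2 * K) hσρ k fun x => ?_
  rw [abs_mul, abs_mul, abs_of_nonneg (sq_nonneg ((x l : ℤ) : ℝ))]
  have hT := abs_cos_sub_one_le_rpow (kdot k x) hσ0 hσ2
  have hu : |kdot k x| ^ σ ≤ (knorm k * jnorm x) ^ σ :=
    Real.rpow_le_rpow (abs_nonneg _) ((abs_kdot_le k x).trans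
      (mul_le_mul_of_nonneg_left (euclidNorm_le_jnorm x) (knorm_nonneg k))) hσ0
  have ht := term_majorant hdec (p := 2) (q := σ) (by ring) x k
  have hj2 : ((x l : ℤ) : ℝ) ^ 2 ≤ jnorm x ^ (2 : ℝ) := by
    rw [Real.rpow_two]
    exact (hxl2 x).trans (pow_le_pow_left₀ (euclidNorm_nonneg x) (euclidNorm_le_jnorm x) 2)
  calc |E x| * (((x l : ℤ) : ℝ) ^ 2 * |Real.cos (kdot k x) - 1|)
      ≤ |E x| * (jnorm x ^ (2 : ℝ) * (2 * (knorm k * jnorm x) ^ σ)) := by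
        refine mul_le_mul_of_nonneg_left (mul_le_mul hj2 (hT.trans (by linarith)) (abs_nonneg _)
          (Real.rpow_nonneg (jnorm_pos x).le _)) (abs_nonneg _)
    _ = 2 * (|E x| * jnorm x ^ (2 : ℝ) * (knorm k * jnorm x) ^ σ) := by ring
    _ ≤ 2 * (K * knorm k ^ σ * jnorm x ^ (-((d : ℝ) + ρ - σ))) := mul_le_mul_of_nonneg_left ht (by norm_num)
    _ = _ := by ring

/-- **`m = 3`** (`σ > 1`): `|Σ_x E(x) x_l³ sin(k·x)| ≤ K(Σ⟦x⟧^{-(d+ρ-σ)})|k|^{σ-1}` (`|sin u| ≤ |u|^{σ-1}`).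
[cite: LiuSlade2026, Lemma 3.4] [cite: LiuSlade2024, Lemma 2.2 and its proof] -/
theorem abs_tsum_mul_cube_mul_sin_le_of_moments
    (hdec : ∀ x, |E x| ≤ K / jnorm x ^ ((d : ℝ) + 2 + ρ)) (hσ1 : 1 < σ) (hσρ : σ < ρ) (hσ2 : σ ≤ 2)
    (l : Fin d) (k : Fin d → ℝ) :
    |∑' x, E x * (((x l : ℤ) : ℝ) ^ 3 * Real.sin (kdot k x))| ≤
      K * (∑' x : Site d, jnorm x ^ (-((d : ℝ) + ρ - σ))) * knorm k ^ (σ - 1) := by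
  refine abs_tsum_le_of_term_le hσρ k fun x => ?_
  rw [abs_mul, abs_mul, abs_pow]
  have hxl : |((x l : ℤ) : ℝ)| ≤ jnorm x := (abs_apply_le_euclidNorm x l).trans (euclidNorm_le_jnorm x)
  have hj3 : |((x l : ℤ) : ℝ)| ^ 3 ≤ jnorm x ^ (3 : ℝ) := by
    rw [show (3 : ℝ) = ((3 : ℕ) : ℝ) by norm_num, Real.rpow_natCast]
    exact pow_le_pow_left₀ (abs_nonneg _) hxl 3
  have hT := abs_sin_le_rpow (kdot k x) (τ := σ - 1) (by linarith) (by linarith)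
  have hu : |kdot k x| ^ (σ - 1) ≤ (knorm k * jnorm x) ^ (σ - 1) :=
    Real.rpow_le_rpow (abs_nonneg _) ((abs_kdot_le k x).trans
      (mul_le_mul_of_nonneg_left (euclidNorm_le_jnorm x) (knorm_nonneg k))) (by linarith)
  have ht := term_majorant hdec (p := 3) (q := σ - 1) (by ring) x k
  calc |E x| * (|((x l : ℤ) : ℝ)| ^ 3 * |Real.sin (kdot k x)|)
      ≤ |E x| * (jnorm x ^ (3 : ℝ) * (knorm k * jnorm x) ^ (σ - 1)) := by
        refine mul_le_mul_of_nonneg_left (mul_le_mul hj3 (hT.trans hu) (abs_nonneg _)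
          (Real.rpow_nonneg (jnorm_pos x).le _)) (abs_nonneg _)
    _ = |E x| * jnorm x ^ (3 : ℝ) * (knorm k * jnorm x) ^ (σ - 1) := by ring
    _ ≤ K * knorm k ^ (σ - 1) * jnorm x ^ (-((d : ℝ) + ρ - σ)) := ht

/-! ## Lemma 3.4 for the pure derivatives -/

/-- **Liu–Slade 2026, Lemma 3.4 (= Liu–Slade 2024, Lemma 2.2) for `α = m e_l`.** Let `E : ℤ^d → ℝ`
be `ℤ^d`-symmetric with `|E(x)| ≤ K/⟦x⟧^{d+2+ρ}` (`K ≥ 0`, `ρ > 0`) and vanishing zeroth and second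
moments `Σ_x E(x) = Σ_x |x|²E(x) = 0`; let `0 ≤ σ < ρ`, `σ ≤ 2` and `m < 2 + σ`. Then the `m`-th slice
derivative of `Ê(k) = Σ_x E(x)cos(k·x)` in the direction `e_l`, the series
`Σ_x E(x) x_l^m cos(k·x + mπ/2)`, obeys `|·| ≤ 3K (Σ_x ⟦x⟧^{-(d+ρ-σ)}) |k|^{2+σ-m}` (`|k|` Euclidean,
`knorm`; the constant depends on `d, ρ, σ` only). [cite: LiuSlade2026, Lemma 3.4] [cite: LiuSlade2024, Lemma 2.2] -/
theorem abs_tsum_moment_cos_le (hE : IsZdSymmetric E) (hK : 0 ≤ K) (hρ : 0 < ρ)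
    (hdec : ∀ x, |E x| ≤ K / jnorm x ^ ((d : ℝ) + 2 + ρ)) (hσ0 : 0 ≤ σ) (hσρ : σ < ρ) (hσ2 : σ ≤ 2)
    (h0 : ∑' x, E x = 0) (h2 : ∑' x, euclidNorm x ^ 2 * E x = 0) (l : Fin d) {m : ℕ}
    (hm : (m : ℝ) < 2 + σ) (k : Fin d → ℝ) :
    |∑' x, E x * (((x l : ℤ) : ℝ) ^ m * Real.cos (kdot k x + m * (π / 2)))| ≤
      3 * K * (∑' x : Site d, jnorm x ^ (-((d : ℝ) + ρ - σ))) * knorm k ^ (2 + σ - m) := by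
  set C : ℝ := ∑' x : Site d, jnorm x ^ (-((d : ℝ) + ρ - σ)) with hC
  have hC0 : 0 ≤ C := tsum_nonneg fun x => Real.rpow_nonneg (jnorm_pos x).le _
  have hkq : ∀ q : ℝ, 0 ≤ knorm k ^ q := fun q => Real.rpow_nonneg (knorm_nonneg k) q
  have hm4 : m < 4 := by
    by_contra h
    push Not at h
    have : (4 : ℝ) ≤ m := by exact_mod_cast h
    linarith
  interval_cases m
  · -- `m = 0`
    simp only [pow_zero, one_mul, Nat.cast_zero, zero_mul, add_zero, sub_zero]
    have h := abs_tsum_mul_cos_le_of_moments hE hρ hdec hσ0 hσρ hσ2 h0 h2 k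
    have : 5 / 2 * K * C * knorm k ^ (2 + σ) ≤ 3 * K * C * knorm k ^ (2 + σ) := by
      have := hkq (2 + σ); nlinarith [mul_nonneg hK hC0]
    exact h.trans this
  · -- `m = 1`
    simp only [pow_one, Nat.cast_one, one_mul, Real.cos_add_pi_div_two]
    have h := abs_tsum_mul_apply_mul_sin_le_of_moments hE hρ hdec hσ0 hσρ hσ2 h2 l k
    rw [show (2 : ℝ) + σ - 1 = 1 + σ by ring]
    rw [show (∑' x, E x * (((x l : ℤ) : ℝ) * -Real.sin (kdot k x))) =
        -∑' x, E x * (((x l : ℤ) : ℝ) * Real.sin (kdot k x)) by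
      rw [← tsum_neg]; exact tsum_congr fun x => by ring, abs_neg]
    have : 2 * K * C * knorm k ^ (1 + σ) ≤ 3 * K * C * knorm k ^ (1 + σ) := by
      have := hkq (1 + σ); nlinarith [mul_nonneg hK hC0]
    exact h.trans this
  · -- `m = 2`
    simp only [Nat.cast_ofNat]
    rw [show (2 : ℝ) * (π / 2) = π by ring, show (2 : ℝ) + σ - 2 = σ by ring]
    simp only [Real.cos_add_pi]
    have h := abs_tsum_mul_sq_mul_cos_le_of_moments hE hρ hdec hσ0 hσρ hσ2 h2 l k
    rw [show (∑' x, E x * (((x l : ℤ) : ℝ) ^ 2 * -Real.cos (kdot k x))) =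
        -∑' x, E x * (((x l : ℤ) : ℝ) ^ 2 * Real.cos (kdot k x)) by
      rw [← tsum_neg]; exact tsum_congr fun x => by ring, abs_neg]
    have : 2 * K * C * knorm k ^ σ ≤ 3 * K * C * knorm k ^ σ := by
      have := hkq σ; nlinarith [mul_nonneg hK hC0]
    exact h.trans this
  · -- `m = 3`
    have hσ1 : 1 < σ := by push_cast at hm; linarith
    simp only [SpreadOutIsing.cos_add_three_pi_div_two]
    rw [show (2 : ℝ) + σ - ((3 : ℕ) : ℝ) = σ - 1 by push_cast; ring]
    have h := abs_tsum_mul_cube_mul_sin_le_of_moments hdec hσ1 hσρ hσ2 l k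
    have : K * C * knorm k ^ (σ - 1) ≤ 3 * K * C * knorm k ^ (σ - 1) := by
      have := hkq (σ - 1); nlinarith [mul_nonneg hK hC0]
    exact h.trans this

end Moments

end Literature.Barriers.CriticalPhenomena

end
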